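/-
Copyright (c) 2026. All rights reserved.
Released under Apache 2.0 license as described in the file LICENSE.
Authors: abc-iut cell, campaign-S prover seat abc-iut-S8 (wave 2).
-/
import Literature.IUT.LogVolume.LogVolumeEstimates
import Literature.IUT.LogVolume.PacketDecomposition
import Literature.IUT.LogVolume.PadicSubfields
import HarnessLib

/-!
# Non-vacuity: the statements of [IUTchIV] Prop. 1.4 (iii)/(iv) over an actual decomposition
# `⊗_{ℚ_p} k_i ≃ ∏_j E_j`, `E_j ⊆ ℚ̄_p`

The log-volume files (`TensorPacketVolume.lean`, `LogVolumeEstimates.lean`) are parametrised by a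
decomposition `ψ : V = ⊗_{ℚ_p} k_i ≃ₐ[ℚ_p] ∏_j L_j` with factors in the cell's norm-side MLF class.  Such a
datum EXISTS for every packet: `PacketDecomposition.exists_packetDecomposition` gives
`ψ : V ≃ₐ ∏_j E_j` with `E_j ⊆ ℚ̄_p = PadicAlgCl p` finite over `ℚ_p` — "finite extensions of `ℚ_p`
contained in `ℚ̄_p`" exactly as in [IUTchIV] Prop. 1.1 (kurims p. 9) — and `PadicSubfields.lean`
(abc-iut-S1) makes every such `E_j` an instance of the setting (`NontriviallyNormedField`, `ProperSpace`;
Mathlib: `NormedAlgebra ℚ_[p]`, `IsUltrametricDist`); the Borel σ-algebra is supplied here (scoped).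
Consequently the typed statements are inhabited by real objects and, e.g., the second inequality of
Prop. 1.4 (iii) holds for them (`exists_decomposition_Prop14iii₂`).  Nothing here bears on the disputed
[IUTchIII] Cor. 3.12.
-/

noncomputable section

open MeasureTheory

namespace Literature.IUT.LogVolume

variable (p : ℕ) [Fact p.Prime]

/-! ## Borel structure on finite subextensions of `ℚ̄_p` (scoped) -/

section Subfield

variable (E : IntermediateField ℚ_[p] (PadicAlgCl p))

/-- The Borel σ-algebra on `E ⊆ ℚ̄_p` (scoped instance; Mathlib declares none on this carrier).
[claim: Mochizuki2012, status: disputed] -/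
scoped instance measurableSpace_subfield : MeasurableSpace E := borel E

/-- `E ⊆ ℚ̄_p` with its Borel σ-algebra is a Borel space. [claim: Mochizuki2012, status: disputed] -/
scoped instance borelSpace_subfield : BorelSpace E := ⟨rfl⟩

end Subfield

/-! ## A real decomposition, and Prop. 1.4 (iii)'s second inequality for it -/

variable {I : Type} [Fintype I] [DecidableEq I]
variable (k : I → Type) [∀ i, NontriviallyNormedField (k i)] [∀ i, NormedAlgebra ℚ_[p] (k i)]
  [∀ i, IsUltrametricDist (k i)] [∀ i, ProperSpace (k i)]

/-- **Non-vacuity of Prop. 1.4 (iii)**: for every packet `(k_i)_{i∈I}`, `|I| ≥ 2`, there is a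
decomposition `ψ : ⊗_{ℚ_p} k_i ≃ₐ[ℚ_p] ∏_j E_j` into finite subextensions `E_j ⊆ ℚ̄_p` (instances of the
setting), and the second displayed inequality of Prop. 1.4 (iii) holds for its log-volume.
[cite: Mochizuki2012, IUTchIV Prop. 1.4 (iii) p. 13] -/
theorem exists_decomposition_Prop14iii₂ :
    ∃ (J : Type) (_ : Fintype J) (E : J → IntermediateField ℚ_[p] (PadicAlgCl p))
      (_ : ∀ j, FiniteDimensional ℚ_[p] (E j)) (ψ : PacketAlgebra p k ≃ₐ[ℚ_[p]] (Π j, E j)),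
      Prop14iii₂ p k (fun j ↦ E j) ψ := by
  obtain ⟨J, hJ, E, hE, ⟨ψ⟩⟩ := exists_packetDecomposition p k
  haveI := hE
  exact ⟨J, hJ, E, hE, ψ, Prop14iii₂_holds p k (fun j ↦ E j) ψ⟩

end Literature.IUT.LogVolume

end
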